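import Summits.RiemannHypothesis.RiemannHypothesis.Theorems.IntegerScrewCensusDualTaylorB
import Summits.RiemannHypothesis.RiemannHypothesis.Theorems.IntegerScrewCensusDualCheckW

/-!
# Route `IntegerScrew` — kernel checker for the census DUAL certificates (6): the cell model as a sum over terms

From the packed integer layer (`accNodes_eq`, `slotZ_packFZ`) to the model polynomial: the constants `kConsts`, the Taylor
weights (`wAt` is the floor of `K₁ c^k/k!`, `K₁ = 2^E D!`, `c = 2φ/2^52`; monotone in `φ`), the digit bounds under the
caps of `dualLight`, and the identities
`evalZ (gList D H acc c0K) σ = c0K + Σ_{a>b} 2Z_ab Re(ẑ_a ẑ_b^* S_ab(σ)) + Σ_a A_a Re(2^52 ẑ_a S_a(σ))`,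
`S_f(σ) = Σ_k W_{f,k} (iσ)^k`, together with the first- and second-derivative versions.  RH-free; nothing here bears on
the truth of RH.
-/

set_option linter.dupNamespace false
set_option autoImplicit false

namespace Summit.RiemannHypothesis.RiemannHypothesis.Theorems.IntegerScrew.Manifest.Fast

open Finset Complex
open Literature.Analysis.ValidatedNumerics.KroneckerDot

/-! ### The constants and the Taylor weights -/

/-- Length of `kConsts`. -/
theorem length_kConsts (D E : ℕ) : (kConsts D E).length = D + 1 := by simp [kConsts]

/-- Entry `k` of `kConsts`. -/
theorem getD_kConsts {D E k : ℕ} (hk : k < D + 1) :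
    (kConsts D E).getD k (0, 0) = (2 ^ (k + E) * Nat.factorial D / Nat.factorial k, 52 * k) := by
  unfold kConsts
  rw [List.getD_eq_getElem _ _ (by simpa using hk)]
  simp

/-- The constant is exact: `(2^{k+E} D!/k!)·k! = 2^{k+E} D!` (`k ≤ D`). -/
theorem kConst_exact {D E k : ℕ} (hk : k ≤ D) : 2 ^ (k + E) * Nat.factorial D / Nat.factorial k * Nat.factorial k = 2 ^ (k + E) * Nat.factorial D :=
  Nat.div_mul_cancel (dvd_mul_of_dvd_right (Nat.factorial_dvd_factorial hk) _)

/-- **The Taylor weight is the floor of `K₁ c^k/k!`** (`K₁ = 2^E D!`, `c = 2φ/2^52`): `K₁c^k/k! − 1 < W_k ≤ K₁c^k/k!`. -/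
theorem wAt_bounds {D E k : ℕ} (hk : k < D + 1) (φ : ℕ) :
    ((2 ^ E * Nat.factorial D : ℕ) : ℝ) * (2 * (φ : ℝ) / 2 ^ 52) ^ k / k.factorial - 1 < (wAt (kConsts D E) φ k : ℝ) ∧
      (wAt (kConsts D E) φ k : ℝ) ≤ ((2 ^ E * Nat.factorial D : ℕ) : ℝ) * (2 * (φ : ℝ) / 2 ^ 52) ^ k / k.factorial := by
  unfold wAt
  rw [getD_kConsts hk]
  simp only
  rw [Nat.shiftRight_eq_div_pow]
  have hpos : (0 : ℕ) < 2 ^ (52 * k) := by positivity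
  obtain ⟨h1, h2⟩ := Literature.NumberTheory.LFunctions.ChainCheck.natDiv_real_bounds (φ ^ k * (2 ^ (k + E) * Nat.factorial D / Nat.factorial k)) hpos
  have hval : ((φ ^ k * (2 ^ (k + E) * Nat.factorial D / Nat.factorial k) : ℕ) : ℝ) / ((2 ^ (52 * k) : ℕ) : ℝ) =
      ((2 ^ E * Nat.factorial D : ℕ) : ℝ) * (2 * (φ : ℝ) / 2 ^ 52) ^ k / k.factorial := by
    have hf : (k.factorial : ℝ) ≠ 0 := by exact_mod_cast (Nat.factorial_pos k).ne'
    have hc : (((2 ^ (k + E) * Nat.factorial D / Nat.factorial k : ℕ)) : ℝ) = 2 ^ (k + E) * (Nat.factorial D : ℝ) / k.factorial := by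
      rw [eq_div_iff hf]
      exact_mod_cast kConst_exact (D := D) (E := E) (by omega)
    push_cast
    rw [hc, pow_mul, div_pow, mul_pow, pow_add]
    field_simp
  rw [hval] at h1 h2
  exact ⟨by linarith, h1⟩

/-- The weight as `|W_k − K₁c^k/k!| ≤ 1`. -/
theorem wAt_abs {D E k : ℕ} (hk : k < D + 1) (φ : ℕ) :
    |(wAt (kConsts D E) φ k : ℝ) - ((2 ^ E * Nat.factorial D : ℕ) : ℝ) * (2 * (φ : ℝ) / 2 ^ 52) ^ k / k.factorial| ≤ 1 := by
  obtain ⟨h1, h2⟩ := wAt_bounds (E := E) hk φ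
  rw [abs_le]; constructor <;> linarith

/-- The weight is monotone in `φ`. -/
theorem wAt_mono (cs : List (ℕ × ℕ)) {φ φ' : ℕ} (h : φ ≤ φ') (k : ℕ) : wAt cs φ k ≤ wAt cs φ' k := by
  unfold wAt
  rw [Nat.shiftRight_eq_div_pow, Nat.shiftRight_eq_div_pow]
  exact Nat.div_le_div_right (Nat.mul_le_mul_right _ (Nat.pow_le_pow_left h k))

/-- The cap check of `dualLight` bounds every weight: `wDigits φmax cs 1` all `< 2^236` and `φ ≤ φmax` give `wAt cs φ k < 2^236`. -/
theorem wAt_lt_of_cap {cs : List (ℕ × ℕ)} {φmax φ k : ℕ} (hall : ∀ w ∈ wDigits φmax cs 1, w < 2 ^ 236) (hφ : φ ≤ φmax)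
    (hk : k < cs.length) : wAt cs φ k < 2 ^ 236 := by
  refine lt_of_le_of_lt (wAt_mono cs hφ k) ?_
  have hmem : (wDigits φmax cs 1).getD k 0 ∈ wDigits φmax cs 1 := by
    rw [List.getD_eq_getElem _ _ (by rw [length_wDigits]; exact hk)]; exact List.getElem_mem _
  have := hall _ hmem
  rw [getD_wDigits φmax cs 1 k hk, one_mul] at this
  exact this

/-! ### `Re(w · i^k)` -/

/-- `Re(w·i^k)` by `k mod 4`: `Re w, −Im w, −Re w, Im w`. -/
theorem re_mul_I_pow (w : ℂ) (k : ℕ) :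
    (w * I ^ k).re = if k % 4 = 0 then w.re else if k % 4 = 1 then -w.im else if k % 4 = 2 then -w.re else w.im := by
  have h4 : I ^ k = I ^ (k % 4) := by
    conv_lhs => rw [← Nat.div_add_mod k 4, pow_add, pow_mul, Complex.I_pow_four, one_pow, one_mul]
  rw [h4]
  have hlt : k % 4 < 4 := Nat.mod_lt _ (by norm_num)
  interval_cases (k % 4) <;> simp [pow_succ, Complex.mul_re]

/-- The selection of `gAt` is `Re((re + i·im)·i^k)`. -/
theorem sel_eq_re (re im : ℤ) (k : ℕ) :
    ((if k % 4 = 0 then re else if k % 4 = 1 then -im else if k % 4 = 2 then -re else im : ℤ) : ℝ) =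
      (((re : ℂ) + (im : ℂ) * I) * I ^ k).re := by
  rw [re_mul_I_pow]
  split_ifs <;> simp

/-! ### The digits of a cell -/

/-- The stored Gaussian integer `ẑ_a = x_a + i y_a` of node `a`. -/
noncomputable def zh (xys : List (ℤ × ℤ)) (a : ℕ) : ℂ := ((xys.getD a (0, 0)).1 : ℂ) + ((xys.getD a (0, 0)).2 : ℂ) * I

/-- The weight series `S_φ(σ) = Σ_{k<L} W_k(φ) (iσ)^k`. -/
noncomputable def wSer (cs : List (ℕ × ℕ)) (φ : ℕ) (σ : ℝ) : ℂ := ∑ k ∈ range cs.length, (wAt cs φ k : ℂ) * (I * σ) ^ k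

/-- The `RE` digit `k` of a cell: `Σ_{a<n} Σ_{b<a} w_{ab,k}(x_a x_b + y_a y_b) + Σ_a w_{a,k} x_a`. -/
def dRE (cs : List (ℕ × ℕ)) (Z : List (List ℤ)) (φs : List ℕ) (xys : List (ℤ × ℤ)) (k : ℕ) : ℤ :=
  ∑ a ∈ range Z.length, ∑ b ∈ range a, pairW cs Z φs a b k *
      ((xys.getD a (0, 0)).1 * (xys.getD b (0, 0)).1 + (xys.getD a (0, 0)).2 * (xys.getD b (0, 0)).2) +
    ∑ a ∈ range Z.length, nodeW cs Z φs a k * (xys.getD a (0, 0)).1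

/-- The `IM` digit `k` of a cell: `Σ_{a<n} Σ_{b<a} w_{ab,k}(y_a x_b − x_a y_b) + Σ_a w_{a,k} y_a`. -/
def dIM (cs : List (ℕ × ℕ)) (Z : List (List ℤ)) (φs : List ℕ) (xys : List (ℤ × ℤ)) (k : ℕ) : ℤ :=
  ∑ a ∈ range Z.length, ∑ b ∈ range a, pairW cs Z φs a b k *
      ((xys.getD a (0, 0)).2 * (xys.getD b (0, 0)).1 - (xys.getD a (0, 0)).1 * (xys.getD b (0, 0)).2) +
    ∑ a ∈ range Z.length, nodeW cs Z φs a k * (xys.getD a (0, 0)).2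

/-- `RE = txx + tyy + nx` and `IM = tyx − txy + ny` are the signed packs of `dRE`, `dIM`. -/
theorem acc_RE_IM (cs : List (ℕ × ℕ)) (Z : List (List ℤ)) (φs : List ℕ) (xys : List (ℤ × ℤ))
    (hsq : ∀ row ∈ Z, row.length = Z.length) (hφ : Z.length ≤ φs.length) (hx : Z.length ≤ xys.length) :
    (accNodes xys (nodeData cs Z φs) xys).txx + (accNodes xys (nodeData cs Z φs) xys).tyy + (accNodes xys (nodeData cs Z φs) xys).nx =
        packFZ cs.length (dRE cs Z φs xys) ∧
      (accNodes xys (nodeData cs Z φs) xys).tyx - (accNodes xys (nodeData cs Z φs) xys).txy + (accNodes xys (nodeData cs Z φs) xys).ny =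
        packFZ cs.length (dIM cs Z φs xys) := by
  have h := accNodes_eq cs Z φs xys hsq hφ hx Z.length 0 (by simp)
  rw [List.drop_zero, List.drop_zero] at h
  rw [h]
  simp only [accDigits, Nat.Ico_zero_eq_range]
  constructor
  · rw [packFZ_add, packFZ_add]
    refine packFZ_congr fun k _ => ?_
    unfold dRE
    rw [← Finset.sum_add_distrib]
    congr 1
    refine Finset.sum_congr rfl fun a _ => ?_
    rw [← Finset.sum_add_distrib]
    exact Finset.sum_congr rfl fun b _ => by ring
  · rw [packFZ_sub, packFZ_add]
    refine packFZ_congr fun k _ => ?_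
    unfold dIM
    rw [← Finset.sum_sub_distrib]
    congr 1
    refine Finset.sum_congr rfl fun a _ => ?_
    rw [← Finset.sum_sub_distrib]
    exact Finset.sum_congr rfl fun b _ => by ring

/-- The complex digit: `dRE_k + i·dIM_k = Σ_{a>b} w_{ab,k} ẑ_a ẑ_b^* + Σ_a w_{a,k} ẑ_a`. -/
theorem digit_complex (cs : List (ℕ × ℕ)) (Z : List (List ℤ)) (φs : List ℕ) (xys : List (ℤ × ℤ)) (k : ℕ) :
    ((dRE cs Z φs xys k : ℤ) : ℂ) + ((dIM cs Z φs xys k : ℤ) : ℂ) * I =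
      ∑ a ∈ range Z.length, ∑ b ∈ range a, (pairW cs Z φs a b k : ℂ) * (zh xys a * (starRingEnd ℂ) (zh xys b)) +
        ∑ a ∈ range Z.length, (nodeW cs Z φs a k : ℂ) * zh xys a := by
  have hconj : ∀ b, (starRingEnd ℂ) (zh xys b) = ((xys.getD b (0, 0)).1 : ℂ) - ((xys.getD b (0, 0)).2 : ℂ) * I := by
    intro b; unfold zh
    simp [map_add, map_mul, Complex.conj_I, sub_eq_add_neg]
  simp_rw [hconj]
  unfold dRE dIM zh
  push_cast
  simp only [add_mul, Finset.sum_mul]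
  rw [add_add_add_comm, ← Finset.sum_add_distrib, ← Finset.sum_add_distrib]
  congr 1
  · refine Finset.sum_congr rfl fun a _ => ?_
    rw [← Finset.sum_add_distrib]
    refine Finset.sum_congr rfl fun b _ => ?_
    have hI : I * I = -1 := Complex.I_mul_I
    linear_combination ((pairW cs Z φs a b k : ℂ) * ((xys.getD a (0, 0)).2 : ℂ) * ((xys.getD b (0, 0)).2 : ℂ)) * hI
  · refine Finset.sum_congr rfl fun a _ => ?_
    ring

/-- Entries of `gList`. -/
theorem getD_gList (D H : ℕ) (acc : CellAcc) (c : ℤ) {k : ℕ} (hk : k < D + 1) :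
    (gList D H acc c).getD k 0 = if k = 0 then gAt H acc 0 + c else gAt H acc k := by
  unfold gList
  rw [List.getD_eq_getElem _ _ (by simpa using hk)]
  simp

/-- `evalZ (gList …) σ = c + Σ_k gAt_k σ^k`. -/
theorem evalZ_gList (D H : ℕ) (acc : CellAcc) (c : ℤ) (σ : ℝ) :
    evalZ (gList D H acc c) σ = (c : ℝ) + ∑ k ∈ range (D + 1), (gAt H acc k : ℝ) * σ ^ k := by
  rw [evalZ_eq_sum, length_gList]
  rw [Finset.sum_range_succ', Finset.sum_range_succ' (fun k => (gAt H acc k : ℝ) * σ ^ k)]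
  rw [getD_gList D H acc c (by omega)]
  simp only [if_true, pow_zero, mul_one, Int.cast_add]
  have : ∀ k ∈ range D, (((gList D H acc c).getD (k + 1) 0 : ℤ) : ℝ) * σ ^ (k + 1) = (gAt H acc (k + 1) : ℝ) * σ ^ (k + 1) := by
    intro k hk
    rw [Finset.mem_range] at hk
    rw [getD_gList D H acc c (by omega)]
    simp
  rw [Finset.sum_congr rfl this]
  ring

/-- Under the slot bound, `gAt` is the selection of the digits. -/
theorem gAt_eq_sel {D E : ℕ} (Z : List (List ℤ)) (φs : List ℕ) (xys : List (ℤ × ℤ))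
    (hsq : ∀ row ∈ Z, row.length = Z.length) (hφ : Z.length ≤ φs.length) (hx : Z.length ≤ xys.length)
    (hRE : ∀ k, k < D + 1 → |dRE (kConsts D E) Z φs xys k| < 2 ^ (SW - 1))
    (hIM : ∀ k, k < D + 1 → |dIM (kConsts D E) Z φs xys k| < 2 ^ (SW - 1)) {k : ℕ} (hk : k < D + 1) :
    gAt (halfPack D) (accNodes xys (nodeData (kConsts D E) Z φs) xys) k =
      (if k % 4 = 0 then dRE (kConsts D E) Z φs xys k else if k % 4 = 1 then -dIM (kConsts D E) Z φs xys k
        else if k % 4 = 2 then -dRE (kConsts D E) Z φs xys k else dIM (kConsts D E) Z φs xys k) := by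
  obtain ⟨h1, h2⟩ := acc_RE_IM (kConsts D E) Z φs xys hsq hφ hx
  unfold gAt
  rw [h1, h2, length_kConsts, slotZ_packFZ hRE hk, slotZ_packFZ hIM hk]

/-- **The model polynomial of a cell as a sum over terms**: if the digits are below the slot bound, then for every `σ`
`evalZ (gList D (halfPack D) acc c) σ = c + Re(Σ_{a>b} 2Z_ab·ẑ_a ẑ_b^*·S_{φ_a−φ_b}(σ) + Σ_a (−2·rowsum_a·2^52)·ẑ_a·S_{φ_a}(σ))`. -/
theorem model_eq {D E : ℕ} (Z : List (List ℤ)) (φs : List ℕ) (xys : List (ℤ × ℤ)) (c : ℤ)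
    (hsq : ∀ row ∈ Z, row.length = Z.length) (hφ : Z.length ≤ φs.length) (hx : Z.length ≤ xys.length)
    (hRE : ∀ k, k < D + 1 → |dRE (kConsts D E) Z φs xys k| < 2 ^ (SW - 1))
    (hIM : ∀ k, k < D + 1 → |dIM (kConsts D E) Z φs xys k| < 2 ^ (SW - 1)) (σ : ℝ) :
    evalZ (gList D (halfPack D) (accNodes xys (nodeData (kConsts D E) Z φs) xys) c) σ =
      (c : ℝ) + (∑ a ∈ range Z.length, ∑ b ∈ range a,
          (2 * ((Z.getD a []).getD b 0 : ℤ) : ℂ) * (zh xys a * (starRingEnd ℂ) (zh xys b)) *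
            wSer (kConsts D E) (φs.getD a 0 - φs.getD b 0) σ +
        ∑ a ∈ range Z.length, ((-2 * sumZ (Z.getD a []) * ((SCL : ℕ) : ℤ) : ℤ) : ℂ) * zh xys a *
          wSer (kConsts D E) (φs.getD a 0) σ).re := by
  rw [evalZ_gList]
  congr 1
  -- each coefficient is `Re((dRE_k + i dIM_k) i^k)`
  have hcoef : ∀ k ∈ range (D + 1), (gAt (halfPack D) (accNodes xys (nodeData (kConsts D E) Z φs) xys) k : ℝ) * σ ^ k =
      ((((dRE (kConsts D E) Z φs xys k : ℤ) : ℂ) + ((dIM (kConsts D E) Z φs xys k : ℤ) : ℂ) * I) * (I * σ) ^ k).re := by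
    intro k hk
    rw [Finset.mem_range] at hk
    rw [gAt_eq_sel Z φs xys hsq hφ hx hRE hIM hk, sel_eq_re, mul_pow,
      show (((dRE (kConsts D E) Z φs xys k : ℤ) : ℂ) + ((dIM (kConsts D E) Z φs xys k : ℤ) : ℂ) * I) * (I ^ k * (σ : ℂ) ^ k) =
        ((((dRE (kConsts D E) Z φs xys k : ℤ) : ℂ) + ((dIM (kConsts D E) Z φs xys k : ℤ) : ℂ) * I) * I ^ k) * ((σ ^ k : ℝ) : ℂ) by
          push_cast; ring, Complex.re_mul_ofReal]
  rw [Finset.sum_congr rfl hcoef, ← Complex.re_sum]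
  congr 1
  -- swap the sums
  simp_rw [digit_complex, add_mul]
  rw [Finset.sum_add_distrib]
  unfold wSer
  rw [length_kConsts]
  congr 1
  · simp_rw [Finset.sum_mul]
    rw [Finset.sum_comm]
    refine Finset.sum_congr rfl fun a _ => ?_
    rw [Finset.sum_comm]
    refine Finset.sum_congr rfl fun b _ => ?_
    rw [Finset.mul_sum]
    refine Finset.sum_congr rfl fun k _ => ?_
    unfold pairW
    push_cast
    ring
  · simp_rw [Finset.sum_mul]
    rw [Finset.sum_comm]
    refine Finset.sum_congr rfl fun a _ => ?_
    rw [Finset.mul_sum]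
    refine Finset.sum_congr rfl fun k _ => ?_
    unfold nodeW
    push_cast
    ring

end Summit.RiemannHypothesis.RiemannHypothesis.Theorems.IntegerScrew.Manifest.Fast
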